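import Mathlib
import Summits.RiemannHypothesis.RiemannHypothesis.Theorems.IntegerScrewTheoremA
import Summits.RiemannHypothesis.RiemannHypothesis.Theorems.IntegerScrewPropKKPackaged
import HarnessLib

/-!
# Route `IntegerScrew` — every bottom of `Ω_R` costs `O(log R·log log R)·D` in the window functional
# (THEOREM A ∧ PROP. K″, CONTINUUM-LIMIT §26.7, §27.3)

THEOREM A (`IntegerScrewTheoremA.theoremA`: `WF² ≤ 210000·(log R/log Q)²·D`, thick bottoms) and PROP. K″ packaged
(`IntegerScrewPropKKPackaged.propKK_thin_bottom`: `WF² ≤ 2000·e²⁰·G(R)·D` when `2e⁵ log Q ≤ log R − log Q`, thin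
bottoms) bound the SAME window functional `WF = Σ_{Q<x≤R} g/x − (S_W/H_Q)·Σ_{b≤Q} g/b`
(`exitMassRatio R Q = S_W/H_Q`).  Outside the K″ regime `log R/log Q < 2e⁵ + 1`, so THEOREM A's bound is an absolute
constant there, smaller than `2000·e²⁰·G(R)`; hence

* **`window_law_loglog`** — for `148 ≤ Q`, `2Q ≤ R` and every `g`:
  `WF² ≤ 2000·e²⁰·(log R + log 4 + e⁵ log(R+1)(log log R + 4))·D_{Ω_R}(g)`,

uniformly in the bottom `Q`, to be used together with `theoremA` as `WF² ≤ min{…}·D` (and `window_law_trivial_smooth`,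
`WF² ≤ 2(1 + (S_W/H_Q)²)·E_K(R)·D`, for the bottoms `Q < 148` / bounded `log R`): in κ-units
κ(Ω_R; Q) ≤ C·min(log R/log Q, (log Q + 1)(log log R + 4)) ≤ C′(1 + (log R·log log R)^{1/2}) (CONTINUUM-LIMIT 27.3).
RH-free, elementary.  Nothing in this file bears on the truth of RH.
References: CONTINUUM-LIMIT §26–27 (rh-explicit A6-PIVOT); M. Suzuki, J. Lond. Math. Soc. (2) 108 (2023) 1448–1487
[Suzuki2023] for the screw matrices this serves.
-/

noncomputable section

set_option linter.dupNamespace false -- D-0017: `Summit.<S>.<S>.…` is the designed namespace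

namespace Summit.RiemannHypothesis.RiemannHypothesis.Theorems.IntegerScrew

open Finset Real
open ArithmeticFunction (vonMangoldt)

/-- **THEOREM A ∧ PROP. K″: the `log log` window law for every bottom of `Ω_R`.**  For `148 ≤ Q`, `2Q ≤ R`, all `g`:
`(Σ_{Q<x≤R} g x/x − exitMassRatio R Q·Σ_{b≤Q} g b/b)² ≤ 2000·e²⁰·(log R + log 4 + e⁵·log(R+1)·(log log R + 4))·D_{Ω_R}(g)`. -/
theorem window_law_loglog {Q R : ℕ} (hQ : 148 ≤ Q) (hQR : 2 * Q ≤ R) (g : ℕ → ℝ) :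
    (∑ x ∈ Ioc Q R, g x / x - exitMassRatio R Q * ∑ b ∈ Icc 1 Q, g b / b) ^ 2 ≤
      2000 * Real.exp 20 *
          (Real.log R + Real.log 4 + Real.exp 5 * Real.log ((R : ℝ) + 1) * (Real.log (Real.log R) + 4)) *
        ∑ x ∈ Icc 1 R, (1 / (x : ℝ)) * ∑ n ∈ x.divisors, (vonMangoldt n : ℝ) * (g x - g (x / n)) ^ 2 := by
  by_cases hreg : 2 * Real.exp 5 * Real.log Q ≤ Real.log R - Real.log Q
  · have h := propKK_thin_bottom (le_trans (by norm_num) hQ) hreg g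
    unfold exitMassRatio
    exact h
  · -- THEOREM A with log R/log Q < 2e⁵ + 1
    have hA := theoremA hQ hQR g
    have hR2 : 2 ≤ R := by omega
    have hQ2 : (148 : ℝ) ≤ Q := by exact_mod_cast hQ
    have hR' : (296 : ℝ) ≤ R := by exact_mod_cast (show 296 ≤ R by omega)
    have hℓ : 0 < Real.log Q := Real.log_pos (by linarith)
    have hQRr : (Q : ℝ) ≤ R := by exact_mod_cast (show Q ≤ R by omega)
    have hL : Real.log Q ≤ Real.log R := Real.log_le_log (by linarith) hQRr
    have hlt : Real.log R - Real.log Q < 2 * Real.exp 5 * Real.log Q := lt_of_not_ge hreg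
    have hratio : Real.log R / Real.log Q ≤ 2 * Real.exp 5 + 1 := by
      rw [div_le_iff₀ hℓ]; linarith
    have hratio0 : 0 ≤ Real.log R / Real.log Q := div_nonneg (by linarith) hℓ.le
    have hsq : (Real.log R / Real.log Q) ^ 2 ≤ (2 * Real.exp 5 + 1) ^ 2 := pow_le_pow_left₀ hratio0 hratio 2
    have he5 := Literature.NumberTheory.LFunctions.SiegelZero.HarmFlat.hundred_le_exp_five
    -- G(R) ≥ log R ≥ 5
    have hG : (5 : ℝ) ≤ Real.log R + Real.log 4 + Real.exp 5 * Real.log ((R : ℝ) + 1) * (Real.log (Real.log R) + 4) := by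
      have h1 : (5 : ℝ) ≤ Real.log R := by
        have : Real.exp 5 ≤ (R : ℝ) := by
          have h5 : Real.exp 5 ≤ 243 := by
            have : Real.exp 5 = Real.exp 1 ^ 5 := by rw [← Real.exp_nat_mul]; norm_num
            rw [this]
            have := Real.exp_one_lt_d9
            have h0 : (0 : ℝ) ≤ Real.exp 1 := (Real.exp_pos 1).le
            nlinarith [pow_le_pow_left₀ h0 (show Real.exp 1 ≤ 3 by linarith) 5]
          linarith
        have := Real.log_le_log (Real.exp_pos 5) this
        rwa [Real.log_exp] at this
      have h2 : 0 ≤ Real.log 4 := Real.log_nonneg (by norm_num)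
      have h3 : 0 ≤ Real.log ((R : ℝ) + 1) := Real.log_nonneg (by linarith)
      have h4 := loglog_add_four_nonneg hR2
      have : 0 ≤ Real.exp 5 * Real.log ((R : ℝ) + 1) * (Real.log (Real.log R) + 4) := by positivity
      linarith
    have hD0 : 0 ≤ ∑ x ∈ Icc 1 R, (1 / (x : ℝ)) * ∑ n ∈ x.divisors, (vonMangoldt n : ℝ) * (g x - g (x / n)) ^ 2 :=
      Finset.sum_nonneg fun x _ => mul_nonneg (by positivity)
        (Finset.sum_nonneg fun n _ => mul_nonneg ArithmeticFunction.vonMangoldt_nonneg (sq_nonneg _))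
    refine hA.trans (mul_le_mul_of_nonneg_right ?_ hD0)
    -- 210000·(2e⁵+1)² ≤ 2000·e²⁰·5
    set x := Real.exp 5 with hx
    have e20 : Real.exp 20 = (x * x) * (x * x) := by
      rw [hx]; simp only [← Real.exp_add]; norm_num
    have hx0 : 0 ≤ x := (Real.exp_pos 5).le
    have h1 : (2 * x + 1) ^ 2 ≤ 9 * (x * x) := by nlinarith
    have h2 : 10000 * (x * x) ≤ (x * x) * (x * x) := by
      have : 10000 ≤ x * x := by nlinarith
      nlinarith
    have hconst : 210000 * (2 * Real.exp 5 + 1) ^ 2 ≤ 2000 * Real.exp 20 * 5 := by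
      rw [e20, ← hx]; nlinarith
    have hE20 : 0 ≤ 2000 * Real.exp 20 := by positivity
    calc 210000 * (Real.log R / Real.log Q) ^ 2 ≤ 210000 * (2 * Real.exp 5 + 1) ^ 2 :=
          mul_le_mul_of_nonneg_left hsq (by norm_num)
      _ ≤ 2000 * Real.exp 20 * 5 := hconst
      _ ≤ _ := mul_le_mul_of_nonneg_left hG hE20

/-- **The trivial window law (small bottoms).**  For `1 ≤ Q ≤ R`, `2 ≤ R`, every `N > Q` and `g`, inside the atom
`𝒜 = {x ≤ R : x N-smooth}` with `W = 𝒜 ∩ (Q, R]`: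
`(Σ_W g/x − (S_W/H_Q)·Σ_{b≤Q} g/b)² ≤ 2·(1 + (S_W/H_Q)²)·E_K(R)·D_𝒜(g)` — both `T_W` and `T_B` are tree functionals
(`subset_root_functional_sq_le_smooth`).  Crude (`S_W/H_Q ≲ log R`), but uniform in `Q ≥ 1`: it covers the bottoms
`Q < 148` of `window_law_loglog` / the cells `R < 298p` when `log R` is bounded. -/
theorem window_law_trivial_smooth {Q R N : ℕ} (hQ : 1 ≤ Q) (hQR : Q ≤ R) (hR : 2 ≤ R) (hQN : Q < N) (g : ℕ → ℝ) :
    (∑ x ∈ (Ioc Q R).filter (· ∈ Nat.smoothNumbers N), g x / x -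
        (∑ x ∈ (Ioc Q R).filter (· ∈ Nat.smoothNumbers N), 1 / (x : ℝ)) / (∑ b ∈ Icc 1 Q, 1 / (b : ℝ)) *
          ∑ b ∈ Icc 1 Q, g b / b) ^ 2 ≤
      2 * (1 + ((∑ x ∈ (Ioc Q R).filter (· ∈ Nat.smoothNumbers N), 1 / (x : ℝ)) /
          (∑ b ∈ Icc 1 Q, 1 / (b : ℝ))) ^ 2) *
        (Real.exp 10 * (Real.log R + Real.log 4 + Real.exp 5 * Real.log ((R : ℝ) + 1) * (Real.log (Real.log R) + 4))) *
        ∑ x ∈ (Icc 1 R).filter (· ∈ Nat.smoothNumbers N),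
          (1 / (x : ℝ)) * ∑ n ∈ x.divisors, (vonMangoldt n : ℝ) * (g x - g (x / n)) ^ 2 := by
  set Wn := (Ioc Q R).filter (· ∈ Nat.smoothNumbers N) with hWn
  set SW := ∑ x ∈ Wn, 1 / (x : ℝ) with hSW
  set HQ := ∑ b ∈ Icc 1 Q, 1 / (b : ℝ) with hHQ
  set D := ∑ x ∈ (Icc 1 R).filter (· ∈ Nat.smoothNumbers N),
    (1 / (x : ℝ)) * ∑ n ∈ x.divisors, (vonMangoldt n : ℝ) * (g x - g (x / n)) ^ 2 with hD
  set EK := Real.exp 10 * (Real.log R + Real.log 4 +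
    Real.exp 5 * Real.log ((R : ℝ) + 1) * (Real.log (Real.log R) + 4)) with hEK
  set TW := ∑ x ∈ Wn, (1 / (x : ℝ)) * (g x - g 1) with hTW
  set TB := ∑ b ∈ Icc 1 Q, (1 / (b : ℝ)) * (g b - g 1) with hTB
  have hHQpos : 0 < HQ := Finset.sum_pos (fun b hb => by
    have := (Finset.mem_Icc.1 hb).1; positivity) ⟨1, Finset.mem_Icc.2 ⟨le_rfl, hQ⟩⟩
  have hW : ∑ x ∈ Wn, g x / x = TW + g 1 * SW := by
    rw [hTW, hSW, Finset.mul_sum, ← Finset.sum_add_distrib]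
    exact Finset.sum_congr rfl fun x _ => by ring
  have hB : ∑ b ∈ Icc 1 Q, g b / b = TB + g 1 * HQ := by
    rw [hTB, hHQ, Finset.mul_sum, ← Finset.sum_add_distrib]
    exact Finset.sum_congr rfl fun x _ => by ring
  have hWF : ∑ x ∈ Wn, g x / x - SW / HQ * ∑ b ∈ Icc 1 Q, g b / b = TW - SW / HQ * TB := by
    rw [hW, hB]; field_simp; ring
  have hTWle : TW ^ 2 ≤ EK * D :=
    subset_root_functional_sq_le_smooth hR N (S := Wn) (fun x hx => by
      have hx' := Finset.mem_filter.1 hx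
      have := Finset.mem_Ioc.1 hx'.1
      exact Finset.mem_filter.2 ⟨Finset.mem_Icc.2 ⟨by omega, this.2⟩, hx'.2⟩) g
  have hTBle : TB ^ 2 ≤ EK * D :=
    subset_root_functional_sq_le_smooth hR N (S := Icc 1 Q) (fun b hb => by
      have := Finset.mem_Icc.1 hb
      exact Finset.mem_filter.2 ⟨Finset.mem_Icc.2 ⟨this.1, this.2.trans hQR⟩,
        Nat.mem_smoothNumbers_of_lt (by omega) (by omega)⟩) g
  rw [hWF]
  set c := SW / HQ with hc
  have h2 : (TW - c * TB) ^ 2 ≤ 2 * TW ^ 2 + 2 * (c * TB) ^ 2 := by nlinarith [sq_nonneg (TW + c * TB)]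
  have h3 : (c * TB) ^ 2 ≤ c ^ 2 * (EK * D) := by
    rw [mul_pow]; exact mul_le_mul_of_nonneg_left hTBle (sq_nonneg c)
  nlinarith [sq_nonneg c]

end Summit.RiemannHypothesis.RiemannHypothesis.Theorems.IntegerScrew

end
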